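import Summits.QuantumFields.QCD.Theses.SpectralDefectExtinction
import Summits.QuantumFields.QCD.Theorems.ExtinctionBuildsQCD.Negative.WithoutTightCollapse
import Literature.MathematicalPhysics.QuantumFieldTheory.QCDPhaseQuenched
import Literature.MathematicalPhysics.QuantumFieldTheory.SpectralDefectDensity

/-!
# Stub `stub_extinctOfDOS` of line `hermitian-flow-coarea`
(crux `Summit.QuantumFields.QCD.Theses.SpectralDefectExtinction.TipPricing`, item stmt-QuantumFields-8967)

**What is proved.** The registered stub `stub_extinctOfDOS` (= the line's named statement
`ExtinctOfDOS`): `CountMeasurable → CoareaExpectation → ∀ N_f reg c m, HeavySideDOS N_f reg c m →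
ExtinctClause N_f reg c m`.  Informally: once (i) the zero-window level count
`N_U(t,η) = #{eigenvalues of H_U(t) in (−η,η)}` of the Hermitian Wilson operator
`H_U(t) = Γ₅ D_W(U,−t,1)` is jointly measurable in `(U,t)` and the real-eigenvalue count of the
massless Wilson–Dirac operator `D_W(U,0,1)` in an open interval is measurable in `U`, and (ii) the
phase-quenched coarea inequality
`2η E_w[#real eig. in (t₁,t₂)] ≤ ∫_{t₁}^{t₂} E_w[N_U(t,η)] dt + 2ηδ` (all small `η`, every slack
`δ > 0`) holds for every continuous weight `w ≥ 0`, the heavy-side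
density-of-states bound `HeavySideDOS` (clause (a) of EXTINCT in `t`-integrated DOS form, clause (b)
verbatim) implies the EXTINCT clause of `WindowExtinction`: eventually in `k`, on every torus
`2S+1 ≥ 2L_k+1`, the phase-quenched mean of
`Σ_f [#{real eig. of D_W(U,0,1) below −m_f(k)} + #{eig. of Γ₅D_W(U,m_f(k),1) in (−cδ_f, cδ_f)}]`
(`δ_f = a_k m_f/Z_m(k)`) is `≤ ε ((2S+1)/(2L_k+1))⁴`.

**Proof route (bookkeeping only).** Fix `ε > 0` and use `HeavySideDOS` at `ε' = ε/(2N_f+1)`; on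
its eventuality set, at a step `k` and a torus side `2S+1`, write
`w_k(U) = ∏_f |det D_W(U, m_f(k), 1)|` (`= ‖det (diracMatrix U m(k))‖`, continuous and bounded on
the compact configuration space: `continuous_det_diracMatrix`, `exists_norm_det_diracMatrix_le`,
`norm_det_diracMatrix`), `Z = ∫ w_k dμ_W`, `r = (2S+1)/(2L_k+1)`.
* Clause (a), flavour `f`, threshold `t_f = −m_f(k)`: every real eigenvalue of `D_W(U,0,1)` lies
  in `[0,8]` (`re_mem_Icc_of_real_root`), so the sign-defect count below `t_f` equals the count in
  the OPEN interval `(−1, t_f)` (`extinctOfDOS_countP_Ioo_eq`); if `t_f ≤ −1` it vanishes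
  identically (`countP_signDefect_eq_zero`), otherwise `CoareaExpectation` on `(−1, t_f)` with
  weight `w_k` together with (A) gives `2η ∫ a_f w_k ≤ 2η ε' r⁴ Z + 2ηδ` for all small `η > 0`
  and every `δ > 0`, whence `∫ a_f w_k ≤ ε' r⁴ Z` (`extinctOfDOS_le_of_coarea`).
* Clause (b) is (B): `∫ b_f w_k ≤ ε' r⁴ Z`.
* The counts are `≤ dim` (`extinctOfDOS_countP_le`) and measurable (`CountMeasurable`: (ii) for
  `a_f`, (i) on the slice `t = −m_f(k)` for `b_f`), `w_k` is continuous and bounded and `μ_W` is a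
  probability measure, so `a_f w_k`, `b_f w_k` are integrable (`extinctOfDOS_integrable_mul`) and
  the numerator splits flavour by flavour: total `≤ 2N_f ε' r⁴ Z ≤ ε r⁴ Z`
  (`extinctOfDOS_abstract`; the case `Z = 0` is the junk value `0 ≤ ε r⁴`).

No named facts are used: everything leaned on is proved in
`Theorems/ExtinctionBuildsQCD/Negative/WithoutTightCollapse.lean`,
`Literature/MathematicalPhysics/QuantumFieldTheory/QCDPhaseQuenched.lean` and Mathlib
(`integral_finsetSum`, `integral_add`, `Integrable.of_bound`, `le_of_forall_pos_le_add`).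
-/

noncomputable section

namespace Summit.QuantumFields.QCD.Cruxes.TipPricing.HermitianFlowCoarea

open scoped BigOperators Topology Classical MeasureTheory Matrix ComplexConjugate
open Filter MeasureTheory
open Literature.MathematicalPhysics.QuantumLattice Literature.MathematicalPhysics.QuantumFieldTheory
  Literature.Probability.LatticeModels
open Summit.QuantumFields.QCD.Theses.SpectralDefectExtinction

/-! ## Helper lemmas (abstract bookkeeping, counts, the weight) -/

/-- An eigenvalue count (with algebraic multiplicity, as a root count of the characteristic
polynomial) never exceeds the dimension. -/
theorem extinctOfDOS_countP_le {n : Type*} [Fintype n] [DecidableEq n] (A : Matrix n n ℂ)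
    (p : ℂ → Prop) [DecidablePred p] : (A.charpoly.roots.countP p : ℝ) ≤ Fintype.card n := by
  exact_mod_cast (Multiset.countP_le_card _ _).trans
    ((Polynomial.card_roots' _).trans_eq (Matrix.charpoly_natDegree_eq_dim A))

/-- A bounded measurable count times a bounded a.e.-strongly measurable weight is integrable
against a finite measure. -/
theorem extinctOfDOS_integrable_mul {X : Type*} [MeasurableSpace X] {μ : Measure X}
    [IsFiniteMeasure μ] {g : X → ℕ} {w : X → ℝ} {C D : ℝ} (hg : Measurable g)
    (hgC : ∀ x, (g x : ℝ) ≤ C) (hw : AEStronglyMeasurable w μ) (hwD : ∀ x, ‖w x‖ ≤ D) :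
    Integrable (fun x => (g x : ℝ) * w x) μ := by
  refine Integrable.of_bound ((measurable_from_nat.comp hg).aestronglyMeasurable.mul hw) (C * D)
    (Eventually.of_forall fun x => ?_)
  rw [norm_mul, Real.norm_natCast]
  exact mul_le_mul (hgC x) (hwD x) (norm_nonneg _) ((Nat.cast_nonneg _).trans (hgC x))

/-- The `η → 0⁺` bookkeeping of clause (a): if `2η I ≤ F(η) + 2ηδ` for all small `η` and every
`δ > 0`, and `F(η)/Z ≤ 2η B` for all small `η`, with `Z > 0`, then `I ≤ B Z`. -/
theorem extinctOfDOS_le_of_coarea {I Z B : ℝ} {F : ℝ → ℝ} (hZ : 0 < Z)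
    (hco : ∀ δ : ℝ, 0 < δ → ∃ η₀ : ℝ, 0 < η₀ ∧ ∀ η : ℝ, 0 < η → η < η₀ →
      2 * η * I ≤ F η + 2 * η * δ)
    (hA : ∃ η₀ : ℝ, 0 < η₀ ∧ ∀ η : ℝ, 0 < η → η < η₀ → F η / Z ≤ 2 * η * B) : I ≤ B * Z := by
  refine le_of_forall_pos_le_add fun δ hδ => ?_
  obtain ⟨η₁, hη₁, h1⟩ := hco δ hδ
  obtain ⟨η₂, hη₂, h2⟩ := hA
  have hm : 0 < min η₁ η₂ := lt_min hη₁ hη₂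
  have k1 := h1 (min η₁ η₂ / 2) (by positivity) (by linarith [min_le_left η₁ η₂])
  have k2 := h2 (min η₁ η₂ / 2) (by positivity) (by linarith [min_le_right η₁ η₂])
  rw [div_le_iff₀ hZ] at k2
  have h3 : 2 * (min η₁ η₂ / 2) * I ≤ 2 * (min η₁ η₂ / 2) * (B * Z + δ) := by linarith
  exact le_of_mul_le_mul_left h3 (by positivity)

/-- **Abstract bookkeeping of the pricing.**  For finitely many flavours `i`, counts `a i, b i ≥ 0`
against a weight `w ≥ 0` with `Z = ∫ w`: if every `a i` vanishes identically unless `-1 < T i`,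
in which case it obeys the coarea inequality with a majorant `F i` whose normalised small-`η` size
is `≤ 2η B`, and every `b i` has normalised mean `≤ B`, then the normalised mean of
`Σ_i (a i + b i)` is `≤ 2 · #ι · B` (the case `Z = 0` being the junk value `0`). -/
theorem extinctOfDOS_abstract {X : Type*} [MeasurableSpace X] {μ : Measure X} {ι : Type*}
    [Fintype ι] {a b : ι → X → ℕ} {w : X → ℝ} {T : ι → ℝ} {F : ι → ℝ → ℝ} {B : ℝ}
    (hw0 : ∀ x, 0 ≤ w x) (hai : ∀ i, Integrable (fun x => (a i x : ℝ) * w x) μ)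
    (hbi : ∀ i, Integrable (fun x => (b i x : ℝ) * w x) μ) (hB : 0 ≤ B)
    (ha0 : ∀ i, T i ≤ -1 → ∀ x, a i x = 0)
    (hco : ∀ i, -1 < T i → ∀ δ : ℝ, 0 < δ → ∃ η₀ : ℝ, 0 < η₀ ∧ ∀ η : ℝ, 0 < η → η < η₀ →
      2 * η * (∫ x, (a i x : ℝ) * w x ∂μ) ≤ F i η + 2 * η * δ)
    (hA : ∀ i, ∃ η₀ : ℝ, 0 < η₀ ∧ ∀ η : ℝ, 0 < η → η < η₀ → F i η / (∫ x, w x ∂μ) ≤ 2 * η * B)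
    (hBc : ∀ i, (∫ x, (b i x : ℝ) * w x ∂μ) / (∫ x, w x ∂μ) ≤ B) :
    (∫ x, (∑ i, ((a i x : ℝ) + (b i x : ℝ))) * w x ∂μ) / (∫ x, w x ∂μ) ≤
      2 * Fintype.card ι * B := by
  set Z := ∫ x, w x ∂μ with hZ
  have hZ0 : 0 ≤ Z := integral_nonneg hw0
  rcases hZ0.eq_or_lt with hZ0 | hZpos
  · rw [← hZ0, div_zero]; positivity
  rw [div_le_iff₀ hZpos]
  have hsplit : ∫ x, (∑ i, ((a i x : ℝ) + (b i x : ℝ))) * w x ∂μ =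
      ∑ i, ((∫ x, (a i x : ℝ) * w x ∂μ) + ∫ x, (b i x : ℝ) * w x ∂μ) := by
    simp_rw [Finset.sum_mul, add_mul]
    rw [integral_finsetSum _ fun i _ => (hai i).fun_add (hbi i)]
    exact Finset.sum_congr rfl fun i _ => integral_add (hai i) (hbi i)
  have ha_le : ∀ i, ∫ x, (a i x : ℝ) * w x ∂μ ≤ B * Z := by
    intro i
    rcases le_or_gt (T i) (-1) with hT | hT
    · have h0 : (fun x => (a i x : ℝ) * w x) = fun _ => 0 :=
        funext fun x => by rw [ha0 i hT x, Nat.cast_zero, zero_mul]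
      rw [h0, integral_zero]
      positivity
    · exact extinctOfDOS_le_of_coarea hZpos (hco i hT) (hA i)
  have hb_le : ∀ i, ∫ x, (b i x : ℝ) * w x ∂μ ≤ B * Z := fun i => (div_le_iff₀ hZpos).1 (hBc i)
  rw [hsplit]
  calc ∑ i, ((∫ x, (a i x : ℝ) * w x ∂μ) + ∫ x, (b i x : ℝ) * w x ∂μ)
      ≤ ∑ _i : ι, (B * Z + B * Z) := Finset.sum_le_sum fun i _ => add_le_add (ha_le i) (hb_le i)
    _ = 2 * Fintype.card ι * B * Z := by
        rw [Finset.sum_const, Finset.card_univ, nsmul_eq_mul]; ring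

open Summit.QuantumFields.QCD.Theorems.ExtinctionBuildsQCD.Negative in
/-- Every real eigenvalue of the massless Wilson–Dirac operator is `≥ 0 > -1`
(`re_mem_Icc_of_real_root`), so the sign-defect count below `t` is the count in the open interval
`(-1, t)`. -/
theorem extinctOfDOS_countP_Ioo_eq {L : ℕ} [NeZero L] (U : GaugeConfig 4 L SU3) (t : ℝ) :
    Multiset.countP (fun z : ℂ => z.im = 0 ∧ -1 < z.re ∧ z.re < t)
        (wilsonDirac (fundamentalRep (Fin 3)) U 0 1).charpoly.roots =
      Multiset.countP (fun z : ℂ => z.im = 0 ∧ z.re < t)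
        (wilsonDirac (fundamentalRep (Fin 3)) U 0 1).charpoly.roots := by
  refine Multiset.countP_congr rfl fun z hz =>
    propext ⟨fun h => ⟨h.1, h.2.2⟩, fun h => ⟨h.1, ?_, h.2⟩⟩
  linarith [(re_mem_Icc_of_real_root U hz h.1).1]

/-- The phase-quenched weight `w(U) = ∏_f ‖det D_W(U, M_f, 1)‖ = ‖det (diracMatrix U M)‖` is
continuous and bounded on the (compact) configuration space. -/
theorem extinctOfDOS_weight {Nf L : ℕ} [NeZero L] (M : Fin Nf → ℝ) :
    (Continuous fun U : GaugeConfig 4 L SU3 =>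
        ∏ f, ‖fermionDet (wilsonDirac (fundamentalRep (Fin 3)) U (M f) 1)‖) ∧
      ∃ D : ℝ, ∀ U : GaugeConfig 4 L SU3,
        ‖∏ f, ‖fermionDet (wilsonDirac (fundamentalRep (Fin 3)) U (M f) 1)‖‖ ≤ D := by
  refine ⟨?_, ?_⟩
  · simpa only [norm_det_diracMatrix] using (continuous_det_diracMatrix (S := L) M).norm
  · obtain ⟨D, hD⟩ := exists_norm_det_diracMatrix_le (S := L) M
    exact ⟨D, fun U => by rw [← norm_det_diracMatrix, norm_norm]; exact hD U⟩

/-! ## The registered stub -/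

/-- **STUB 5 · `stub_extinctOfDOS`** — the coarea pricing applied: measurability and the phase-quenched coarea
inequality turn the heavy-side density-of-states bound `HeavySideDOS` into the EXTINCT clause of `WindowExtinction`. -/
theorem stub_extinctOfDOS :
    ((∀ (L : ℕ) [NeZero L] (η : ℝ), Measurable fun p : GaugeConfig 4 L SU3 × ℝ => Multiset.countP
      (fun z : ℂ => |z.re| < η) (spinorLift gammaFive * wilsonDirac (fundamentalRep (Fin 3)) p.1
      (-p.2) 1).charpoly.roots) ∧ (∀ (L : ℕ) [NeZero L] (t₁ t₂ : ℝ), Measurable fun U : GaugeConfig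
      4 L SU3 => Multiset.countP (fun z : ℂ => z.im = 0 ∧ t₁ < z.re ∧ z.re < t₂) (wilsonDirac
      (fundamentalRep (Fin 3)) U 0 1).charpoly.roots)) → (∀ (L : ℕ) [NeZero L] (β : ℝ) (w :
      GaugeConfig 4 L SU3 → ℝ), Continuous w → (∀ U, 0 ≤ w U) → ∀ t₁ t₂ : ℝ, t₁ < t₂ → ∀ δ : ℝ, 0 <
      δ → ∃ η₀ : ℝ, 0 < η₀ ∧ ∀ η : ℝ, 0 < η → η < η₀ → 2 * η * (∫ U, (Multiset.countP (fun z : ℂ =>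
      z.im = 0 ∧ t₁ < z.re ∧ z.re < t₂) (wilsonDirac (fundamentalRep (Fin 3)) U 0 1).charpoly.roots
      : ℝ) * w U ∂(wilsonMeasure (fundamentalRep (Fin 3)) β : Measure (GaugeConfig 4 (L) SU3))) ≤ (∫
      t in t₁..t₂, (∫ U, (Multiset.countP (fun z : ℂ => |z.re| < η) (spinorLift gammaFive *
      wilsonDirac (fundamentalRep (Fin 3)) U (-t) 1).charpoly.roots : ℝ) * w U ∂(wilsonMeasure
      (fundamentalRep (Fin 3)) β : Measure (GaugeConfig 4 (L) SU3)))) + 2 * η * δ) → ∀ (Nf : ℕ) (reg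
      : QCDRegularisation Nf) (c : ℝ) (m : Fin Nf → ℝ), (∀ ε : ℝ, 0 < ε → ∀ᶠ k : ℕ in Filter.atTop,
      ∀ S : ℕ, reg.L k ≤ S → ∀ f : Fin Nf, (∃ η₀ : ℝ, 0 < η₀ ∧ ∀ η : ℝ, 0 < η → η < η₀ → (∫ t in (-1
      : ℝ)..(-(reg.mcrit k + reg.a k * m f / reg.Zm k)), (∫ U, (Multiset.countP (fun z : ℂ => |z.re|
      < η) (spinorLift gammaFive * wilsonDirac (fundamentalRep (Fin 3)) U (-t) 1).charpoly.roots :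
      ℝ) * ∏ f : Fin Nf, ‖fermionDet (wilsonDirac (fundamentalRep (Fin 3)) U (reg.mcrit k + reg.a k
      * m f / reg.Zm k) 1)‖ ∂(wilsonMeasure (fundamentalRep (Fin 3)) (reg.β k) : Measure
      (GaugeConfig 4 (2 * S + 1) SU3)))) / (∫ U, ∏ f : Fin Nf, ‖fermionDet (wilsonDirac
      (fundamentalRep (Fin 3)) U (reg.mcrit k + reg.a k * m f / reg.Zm k) 1)‖ ∂(wilsonMeasure
      (fundamentalRep (Fin 3)) (reg.β k) : Measure (GaugeConfig 4 (2 * S + 1) SU3))) ≤ 2 * η * (ε *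
      ((2 * S + 1 : ℝ) / (2 * reg.L k + 1)) ^ 4)) ∧ (∫ U, (Multiset.countP (fun z : ℂ => |z.re| < c
      * (reg.a k * m f / reg.Zm k)) (spinorLift gammaFive * wilsonDirac (fundamentalRep (Fin 3)) U
      (reg.mcrit k + reg.a k * m f / reg.Zm k) 1).charpoly.roots : ℝ) * ∏ f : Fin Nf, ‖fermionDet
      (wilsonDirac (fundamentalRep (Fin 3)) U (reg.mcrit k + reg.a k * m f / reg.Zm k) 1)‖
      ∂(wilsonMeasure (fundamentalRep (Fin 3)) (reg.β k) : Measure (GaugeConfig 4 (2 * S + 1) SU3)))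
      / (∫ U, ∏ f : Fin Nf, ‖fermionDet (wilsonDirac (fundamentalRep (Fin 3)) U (reg.mcrit k + reg.a
      k * m f / reg.Zm k) 1)‖ ∂(wilsonMeasure (fundamentalRep (Fin 3)) (reg.β k) : Measure
      (GaugeConfig 4 (2 * S + 1) SU3))) ≤ ε * ((2 * S + 1 : ℝ) / (2 * reg.L k + 1)) ^ 4) → (∀ ε : ℝ,
      0 < ε → ∀ᶠ k : ℕ in Filter.atTop, ∀ S : ℕ, reg.L k ≤ S → (∫ U, ((∑ f : Fin Nf,
      ((Multiset.countP (fun z : ℂ => z.im = 0 ∧ z.re < -(reg.mcrit k + reg.a k * m f / reg.Zm k))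
      (wilsonDirac (fundamentalRep (Fin 3)) U 0 1).charpoly.roots : ℝ) + (Multiset.countP (fun z : ℂ
      => |z.re| < c * (reg.a k * m f / reg.Zm k)) (spinorLift gammaFive * wilsonDirac
      (fundamentalRep (Fin 3)) U (reg.mcrit k + reg.a k * m f / reg.Zm k) 1).charpoly.roots : ℝ))))
      * ∏ f : Fin Nf, ‖fermionDet (wilsonDirac (fundamentalRep (Fin 3)) U (reg.mcrit k + reg.a k * m
      f / reg.Zm k) 1)‖ ∂(wilsonMeasure (fundamentalRep (Fin 3)) (reg.β k) : Measure (GaugeConfig 4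
      (2 * S + 1) SU3))) / (∫ U, ∏ f : Fin Nf, ‖fermionDet (wilsonDirac (fundamentalRep (Fin 3)) U
      (reg.mcrit k + reg.a k * m f / reg.Zm k) 1)‖ ∂(wilsonMeasure (fundamentalRep (Fin 3)) (reg.β
      k) : Measure (GaugeConfig 4 (2 * S + 1) SU3))) ≤ ε * ((2 * S + 1 : ℝ) / (2 * reg.L k + 1)) ^
      4) := by
  intro hMeas hCo Nf reg c m hDOS ε hε
  have hε' : 0 < ε / (2 * Nf + 1) := by positivity
  filter_upwards [hDOS _ hε'] with k hk S hS
  obtain ⟨hwc, D, hD⟩ := extinctOfDOS_weight (L := 2 * S + 1)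
    (fun f : Fin Nf => reg.mcrit k + reg.a k * m f / reg.Zm k)
  have hw0 : ∀ U : GaugeConfig 4 (2 * S + 1) SU3, 0 ≤ ∏ f : Fin Nf, ‖fermionDet
      (wilsonDirac (fundamentalRep (Fin 3)) U (reg.mcrit k + reg.a k * m f / reg.Zm k) 1)‖ :=
    fun U => Finset.prod_nonneg fun f _ => norm_nonneg _
  refine (extinctOfDOS_abstract
    (μ := (wilsonMeasure (fundamentalRep (Fin 3)) (reg.β k) :
      Measure (GaugeConfig 4 (2 * S + 1) SU3)))
    (a := fun (f : Fin Nf) (U : GaugeConfig 4 (2 * S + 1) SU3) => Multiset.countP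
      (fun z : ℂ => z.im = 0 ∧ z.re < -(reg.mcrit k + reg.a k * m f / reg.Zm k))
      (wilsonDirac (fundamentalRep (Fin 3)) U 0 1).charpoly.roots)
    (w := fun U : GaugeConfig 4 (2 * S + 1) SU3 => ∏ f : Fin Nf, ‖fermionDet
      (wilsonDirac (fundamentalRep (Fin 3)) U (reg.mcrit k + reg.a k * m f / reg.Zm k) 1)‖)
    (T := fun f : Fin Nf => -(reg.mcrit k + reg.a k * m f / reg.Zm k))
    (B := ε / (2 * Nf + 1) * ((2 * S + 1 : ℝ) / (2 * reg.L k + 1)) ^ 4)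
    hw0 (fun f => ?_) (fun f => ?_) (by positivity) (fun f hT U => ?_) (fun f hT δ hδ => ?_)
    (fun f => (hk S hS f).1) (fun f => (hk S hS f).2)).trans ?_
  · -- integrability of (sign-defect count) × weight: measurable (stub 2 (ii)) and bounded
    have hm := hMeas.2 (2 * S + 1) (-1) (-(reg.mcrit k + reg.a k * m f / reg.Zm k))
    simp only [extinctOfDOS_countP_Ioo_eq] at hm
    exact extinctOfDOS_integrable_mul hm (fun U => extinctOfDOS_countP_le _ _)
      hwc.aestronglyMeasurable hD
  · -- integrability of (window count) × weight: measurable (stub 2 (i) on the slice `t = -m_f(k)`)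
    have hm := (hMeas.1 (2 * S + 1) (c * (reg.a k * m f / reg.Zm k))).comp
      (measurable_id.prodMk (measurable_const (a := -(reg.mcrit k + reg.a k * m f / reg.Zm k))))
    simp only [Function.comp_def, id_eq, neg_neg] at hm
    exact extinctOfDOS_integrable_mul hm (fun U => extinctOfDOS_countP_le _ _)
      hwc.aestronglyMeasurable hD
  · -- no sign defects below a threshold `≤ -1 ≤ 0`
    beta_reduce at hT
    exact Theorems.ExtinctionBuildsQCD.Negative.countP_signDefect_eq_zero U (by linarith)
  · -- the phase-quenched coarea inequality on `(-1, t_f(k))`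
    beta_reduce at hT
    simpa only [extinctOfDOS_countP_Ioo_eq] using
      hCo (2 * S + 1) (reg.β k) _ hwc hw0 (-1) _ hT δ hδ
  · -- `2 N_f · ε/(2 N_f + 1) ≤ ε`
    rw [Fintype.card_fin]
    have hN : (0 : ℝ) < 2 * Nf + 1 := by positivity
    calc 2 * (Nf : ℝ) * (ε / (2 * Nf + 1) * ((2 * S + 1 : ℝ) / (2 * reg.L k + 1)) ^ 4)
        = (2 * Nf / (2 * Nf + 1)) * (ε * ((2 * S + 1 : ℝ) / (2 * reg.L k + 1)) ^ 4) := by ring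
      _ ≤ 1 * (ε * ((2 * S + 1 : ℝ) / (2 * reg.L k + 1)) ^ 4) := by
          gcongr
          rw [div_le_one hN]
          linarith
      _ = _ := one_mul _

end Summit.QuantumFields.QCD.Cruxes.TipPricing.HermitianFlowCoarea

end
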